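import Summits.QuantumFields.YangMills.Theorems.BalabanUVNodesN16Thm4TorusOfHP2PerEntry

/-!
# Route «BalabanUVNodes», crux K3⁸ `SpineGivenEndpointR13SepCoPHV` (stmt-QuantumFields-27366), node N16 = NE3 — THE UNIFORM-IN-k KNIT: Theorem-4 ∧ Proposition-3 BODIES of
# node N05's periodic δ₂-model with ONE threshold pair for ALL periods `P_k = Nper·Lᵏ` (node N05's ∀-P «Σ» edition, dag-n05-d g22 INTENT-Σ1) ⟹ node N16's chain-entry
# hypothesis `∀ k ≥ 1, Thm4TorusAt L k (Nper·Lᵏ) (Lᵏ)⁻¹ c₁′ (unitaryUnits 𝔸) (Reg k) (Restr129 L k (torusLam k)) Concl_entry(B, B_h; β)` with ONE `c₁′`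

Cell `pub-ymgap`, seat `pub-ymgap-dag-n16-e` (R134 (a), strategy s2; HUMAN RULING D-0062; chair R424 venue), generation 23.  `--kind proof --supports stmt-QuantumFields-27366 --as helper`
(count-neutral; proves NO registered stub).  `bears_on: R4∕N16 · edge N05 → N16`.

WHY ((g6) of this seat's LOCATED note «N16 ∕ N05 record-currency seam»; dag-n05-d g22's answer I.44170: «Theorem 4's threshold is chosen BEFORE the index and before the sockets …
cure (i) done right = the ∀-P (Σ) EDITION, typed N05-side NOW: ONE threshold pair (c₄, c₃) and ONE letter set for ALL periods … conclusion per `a : IdxB8SubDPerκ θ P Mκ Rκ`: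
`B8.Thm4Body c₄ (5DL·B₈) (fun _ : Unit ↦ (zdGF3HP₂Per θ.𝔸 θ.L β len a.toZdIdx P).toGFData) ∧ B8.Prop3Body c₃ θ.D θ.L C₂ inp B₀β (fun _ : Unit ↦ (…).toGFData2)` = EXACTLY the
`hT`∕`hP` inputs of `…HP2PerPrint.thm4TorusAt_print_of_hp2per_member`; your top knit = per k, `obtain` once, feed `(H P_k … a_k).1 ∕ .2`»).  THIS FILE is that knit with node N05's
Σ-conclusion DISPLAYED as the hypothesis `hΣ` (per depth `k ≥ 1`, at the period `Nper·Lᵏ`, for every member of the κ-cut — only the truncated all-torus member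
`B8IdxB8SubDPerUnivFam.exists_idxB8SubDPerκ_univFam` is read): ONE window letter `c₁′` (n16-c's `…N16OfLeaf.exists_window_print` at the uniform thresholds) serves every `k`, and
the conclusion is node N16's chain-entry hypothesis `…N16HolderOfThm4Output.n16_holder_of_thm4TorusAt_print` letter for letter (`conjR` = `Ad` on matrices, `rfl`).  When INTENT-Σ1
lands, `hΣ` is its conclusion instantiated at `P := Nper·Lᵏ` under its seven per-period antecedents (node N06's binders, [4]'s letters — displayed there).

WHAT THIS FILE PROVES (kernel; theorems only, 0 `def`, 0 `sorry`): ★★★ `thm4TorusAt_entry_forall_depth_of_uniform_bodies` (given `c₁′` in the window: `∀ k ≥ 1`, the entry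
`Thm4TorusAt` at `Nper·Lᵏ`) and ★★★ `exists_window_thm4TorusAt_entry_forall_depth_of_uniform_bodies` (`∃ c₁′ > 0` with the window AND the `∀ k` conclusion — the shape
`n16_holder_of_thm4TorusAt_print` quantifies).

HONEST FRAMING.  Bookkeeping BY NAME; no estimate; `hΣ` (Theorem 4 ∧ Proposition 3 bodies of node N05's periodic δ₂-model, uniform thresholds) is a HYPOTHESIS — node N05's Σ-edition
is ANNOUNCED (INTENT-Σ1 I.44171), not landed at the time of writing; nothing of Bałaban asserted; no stub closed or claimed; N16 ∕ N05 NOT discharged; counts UNMOVED (typed 28∕28 ·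
discharged 5∕27 · A 5∕28).  One finite four-torus at fixed `ε` — NOT ℝ⁴, NOT infinite volume, NOT OS, NOT a mass gap; the YM mass gap (Clay) is NOT proved by any of this.
References: [Balaban1985RegularSpaces] T. Bałaban, CMP **99** (1985) 75–102, Thm 4 p. 88 («There exists a constant c₁»), Prop. 3 p. 87, (1.36)–(1.39) pp. 82–83, p. 77.
-/

set_option autoImplicit false

open scoped BigOperators
open NormedSpace

namespace Summit.QuantumFields.YangMills.BalabanUVNodes.N16.Thm4TorusOfHP2PerUniform

open Literature.MathematicalPhysics.QuantumFieldTheory.Balaban1983to89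
open B7Prop1Explicit B7Prop2Explicit
open B7Prop3Flat (c3)
open B7Eq78Linearization (conjR)
open B7Eq92Concrete (mgauge)
open B8Ineq132 (covDerivFwd)
open B8Eq184Proof (cfgExp)
open B8Eq119TwistedAxial (Restr129)
open B8Eq138LandauZd (IsLandau138 covLap)
open B9Eq340HolderZd (AdmPair mem_admPair)
open B8Thm4TorusAt (torusLam Thm4TorusAt)
open B8LeafModelZdHP2Per (zdGF3HP₂Per)
open T4TermwiseTorus (IsPeriodic)
open Node00 (Stage3Params IdxB8SubDPerκ)
open B8Eq134Admissible (univFam)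
open B8IdxB8SubDPerUnivFam (exists_idxB8SubDPerκ_univFam univFam_of_le)
open Thm4TorusOfHP2PerPrint (thm4TorusAt_print_of_hp2per_member)
open Thm4TorusOfHP2PerEntry (isPeriodic_iff_forall_e)
open OfLeaf (thm4TorusAt_concl_congr exists_window_print)

noncomputable section

/-- **★★★ THE UNIFORM-IN-k KNIT.**  Stage-3 parameters `θ` (`θ.D ≥ 2`), torus count `Nper ≥ 1`, pins `(Mκ, Rκ)`; ONE Hölder pair `(β, len)` (`0 ≤ β`, `len ≥ 1` on its support,
`len (e μ) = 1`), ONE set of constants `(c₄, c₃, B₁′, C₂, inp, B₀β)` with `0 < B₁′`, `5·D·L·inp.B₀ ≤ B₁′`; the Σ-hypothesis `hΣ`: at every depth `k ≥ 1`, every member of the κ-cut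
at the period `Nper·Lᵏ` carries Theorem 4's body at threshold `c₄` and Proposition 3's body at threshold `c₃` for node N05's periodic δ₂-model (node N05's ∀-P edition, displayed).
THEN every `c₁′` in the eleven-line window (w.r.t. `c₄, c₃, B₁′, C₂`) gives, for EVERY `k ≥ 1` and every `Reg`:
`Thm4TorusAt θ.L k (Nper·Lᵏ) (Lᵏ)⁻¹ c₁′ (unitaryUnits θ.𝔸) (Reg k) (Restr129 θ.L k (torusLam k)) Concl_entry(5DL·inp.B₀, 5DL·B₀β; β)` — node N16's chain-entry letters.
Per k: the `univFam k` member of `IdxB8SubDPerκ θ (Nper·Lᵏ) Mκ Rκ` (`Lᵏ ∣ Nper·Lᵏ`), `…HP2PerPrint.thm4TorusAt_print_of_hp2per_member` at it, then the η = L⁻ᵏ ∕ `len e_μ = 1` letter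
identities through `thm4TorusAt_concl_congr`. [cite: Balaban1985RegularSpaces, Thm 4 p.88, Prop. 3 p.87, (1.36)–(1.39) pp.82–83, p.77 («we admit the case where some domains Ω_j are equal to T_η»)] -/
theorem thm4TorusAt_entry_forall_depth_of_uniform_bodies {θ : Stage3Params} (hD : 2 ≤ θ.D) {Nper : ℕ} (hN : 1 ≤ Nper) (Mκ Rκ : ℕ)
    {β : ℝ} (hβ : 0 ≤ β) {len : Site θ.D → ℝ} (hlen : ∀ v : Site θ.D, 0 < len v → 1 ≤ len v) (hlen1 : ∀ μ : Fin θ.D, len (e μ) = 1)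
    {c₄ c₃ c₁' B₁' C₂ B₀β : ℝ} {inp : B8.B9Inputs} (hB₁' : 0 < B₁') (hBB : 5 * (θ.D : ℝ) * θ.L * inp.B₀ ≤ B₁')
    (hwin : ∀ α₀ α₁ : ℝ, 0 < α₀ → 0 < α₁ → α₀ + α₁ ≤ c₁' →
      α₀ + α₁ ≤ c₄ ∧ C0 θ.D * (2 * α₀) ≤ 1 / 3 ∧ 4 * α₀ ≤ c2' θ.D θ.L ∧ 16 * (B₁' * (α₀ + α₁)) ≤ 1 ∧
      Real.exp (4 * (800 * ((θ.D : ℝ) + 1) ^ 2 * ((θ.D : ℝ) + 4)) * α₀) * (1 + 8 * (131072 * ((θ.D : ℝ) + 1) ^ 2) * (B₁' * (α₀ + α₁))) ≤ 2 ∧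
      2 * (B₁' * (α₀ + α₁)) ≤ c3 θ.D θ.L ∧ (θ.D : ℝ) * θ.L * α₁ ≤ 1 / 8 ∧ α₀ ≤ c₃ ∧ α₁ ≤ c₃ ∧ B₁' * (α₀ + α₁) ≤ c₃ ∧
      2 * (B₁' * (α₀ + α₁)) ^ 2 + 20 * θ.D * α₀ * (B₁' * (α₀ + α₁)) + 2 * C₂ * (B₁' * (α₀ + α₁)) ^ 2 ≤ α₀ + α₁)
    (hSig : ∀ k, 1 ≤ k → ∀ a : IdxB8SubDPerκ θ (Nper * θ.L ^ k) Mκ Rκ,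
      B8.Thm4Body c₄ B₁' (fun _ : Unit => (zdGF3HP₂Per θ.𝔸 θ.L β len a.toZdIdx (Nper * θ.L ^ k)).toGFData) ∧
      B8.Prop3Body c₃ θ.D (θ.L : ℝ) C₂ inp B₀β (fun _ : Unit => (zdGF3HP₂Per θ.𝔸 θ.L β len a.toZdIdx (Nper * θ.L ^ k)).toGFData2))
    (Reg : ℕ → (Site θ.D → Fin θ.D → θ.𝔸ˣ) → Prop) :
    ∀ k, 1 ≤ k → Thm4TorusAt θ.L k (((Nper * θ.L ^ k : ℕ) : ℤ)) (((θ.L : ℝ) ^ k)⁻¹) c₁' (unitaryUnits θ.𝔸) (Reg k) (Restr129 θ.L k (torusLam k))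
      (fun (α₀ α₁ : ℝ) (U₀ U' : Site θ.D → Fin θ.D → θ.𝔸ˣ) (u : Site θ.D → θ.𝔸ˣ) =>
        ∃ A : Site θ.D → Fin θ.D → θ.𝔸,
          (∀ x μ, IsSelfAdjoint (A x μ)) ∧ (∀ (x : Site θ.D) (κ μ : Fin θ.D), A (x + (((Nper * θ.L ^ k : ℕ) : ℤ)) • e κ) μ = A x μ) ∧
          mgauge U₀ u (cfgExp (((θ.L : ℝ) ^ k)⁻¹) A) = U' ∧
          (∀ x μ, ‖A x μ‖ ≤ 5 * (θ.D : ℝ) * θ.L * inp.B₀ * (α₀ + α₁)) ∧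
          (∀ (μ : Fin θ.D) (x : Site θ.D) (κ : Fin θ.D),
            ‖covDerivFwd (((θ.L : ℝ) ^ k)⁻¹) U₀ μ (fun z => A z κ) x‖ ≤ 5 * (θ.D : ℝ) * θ.L * inp.B₀ * (α₀ + α₁)) ∧
          IsLandau138 θ.L k (((θ.L : ℝ) ^ k)⁻¹) Set.univ (torusLam k) U₀ A ∧
          (∀ (μ : Fin θ.D) (y : Site θ.D) (κ : Fin θ.D),
            ‖conjR (U₀ y μ) (covDerivFwd (((θ.L : ℝ) ^ k)⁻¹) U₀ μ (fun z => A z κ) (y + e μ)) - covDerivFwd (((θ.L : ℝ) ^ k)⁻¹) U₀ μ (fun z => A z κ) y‖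
              ≤ 5 * (θ.D : ℝ) * θ.L * B₀β * (α₀ + α₁) * (((θ.L : ℝ)⁻¹) ^ k) ^ β) ∧
          (∀ (x : Site θ.D) (κ : Fin θ.D),
            ‖covLap (((θ.L : ℝ) ^ k)⁻¹) U₀ (fun z => A z κ) x‖ ≤ 5 * (θ.D : ℝ) * θ.L * inp.B₀ * (α₀ + α₁))) := by
  intro k hk
  have hLpos : 0 < θ.L := lt_of_lt_of_le (by norm_num) θ.two_le_L
  have hP : 0 < Nper * θ.L ^ k := Nat.mul_pos (lt_of_lt_of_le Nat.zero_lt_one hN) (pow_pos hLpos k)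
  obtain ⟨j, hη, hjk, hΩ⟩ := exists_idxB8SubDPerκ_univFam θ Mκ Rκ hk hP (dvd_mul_left _ _)
  obtain ⟨hT, hPr⟩ := hSig k hk j
  -- the member's sets on the levels read
  have hΩ' : ∀ l, l ≤ j.toZdIdx.k → j.toZdIdx.Ω l = Set.univ := fun l hl => by
    rw [hΩ]; exact univFam_of_le (by rw [hjk] at hl; exact hl)
  have hΛs' : ∀ m, m ≤ j.toZdIdx.k → ∀ l, l ≤ m → j.toZdIdx.Λs m l = torusLam m l := fun m hm l hl => by
    rw [B8IdxB8SubDPerUnivFam.IdxB8SubDPerκ.Λs_univFam j hΩ hjk (by rw [hjk] at hm; exact hm) hl]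
    rfl
  have h := thm4TorusAt_print_of_hp2per_member (𝔸 := θ.𝔸) hD θ.two_le_L hβ hlen j.toZdIdx (Nper * θ.L ^ k) hΩ' hΛs' hB₁' hBB hwin (Reg k)
    (hT ()) (hPr ())
  rw [hη, hjk] at h
  refine thm4TorusAt_concl_congr (fun α₀ α₁ U₀ U' u => ?_) h
  -- the letter identities at `η = L^{-k}`
  have hL1r : (1 : ℝ) ≤ θ.L := by exact_mod_cast le_trans (by norm_num) θ.two_le_L
  have hLk : (1 : ℝ) ≤ (θ.L : ℝ) ^ k := one_le_pow₀ hL1r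
  have hη1 : ((θ.L : ℝ) ^ k)⁻¹ ≤ 1 := inv_le_one_of_one_le₀ hLk
  have hw : (θ.L : ℝ) ^ k * ((θ.L : ℝ) ^ k)⁻¹ = 1 := mul_inv_cancel₀ (by positivity)
  have hw2 : ((θ.L : ℝ) ^ k * ((θ.L : ℝ) ^ k)⁻¹) ^ (-(2 : ℝ)) = 1 := by rw [hw, Real.one_rpow]
  have hw3 : ((θ.L : ℝ) ^ k * ((θ.L : ℝ) ^ k)⁻¹) ^ (-(3 : ℝ)) = 1 := by rw [hw, Real.one_rpow]
  have hwβ : ((θ.L : ℝ) ^ k * ((θ.L : ℝ) ^ k)⁻¹) ^ (-(2 + β)) = 1 := by rw [hw, Real.one_rpow]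
  have hηβ : ∀ μ : Fin θ.D, (((θ.L : ℝ) ^ k)⁻¹ * len (e μ)) ^ β = (((θ.L : ℝ)⁻¹) ^ k) ^ β := fun μ => by
    rw [hlen1 μ, mul_one, inv_pow]
  have hadm : ∀ (μ : Fin θ.D) (y : Site θ.D), (y, y + e μ) ∈ AdmPair (((θ.L : ℝ) ^ k)⁻¹) len := fun μ y => by
    rw [mem_admPair]
    simp only [add_sub_cancel_left, hlen1 μ, mul_one]
    exact ⟨one_pos, hη1⟩
  constructor
  · rintro ⟨A, h1, hper, h2, h3, h4, h5, h6, h7⟩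
    refine ⟨A, h1, (isPeriodic_iff_forall_e _ A).1 hper, h2, fun x μ => ?_, fun μ x κ => ?_, h5, fun μ y κ => ?_, fun x κ => ?_⟩
    · have h := h3 x μ; rwa [hw, inv_one, mul_one] at h
    · have h := h4 μ x κ; rwa [hw2, mul_one] at h
    · have h := h6 μ y κ (hadm μ y); rwa [hwβ, mul_one, hηβ μ] at h
    · have h := h7 x κ; rwa [hw3, mul_one] at h
  · rintro ⟨A, h1, hper, h2, h3, h4, h5, h6, h7⟩
    refine ⟨A, h1, (isPeriodic_iff_forall_e _ A).2 hper, h2, fun x μ => ?_, fun μ x κ => ?_, h5, fun μ y κ _ => ?_, fun x κ => ?_⟩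
    · rw [hw, inv_one, mul_one]; exact h3 x μ
    · rw [hw2, mul_one]; exact h4 μ x κ
    · rw [hwβ, mul_one, hηβ μ]; exact h6 μ y κ
    · rw [hw3, mul_one]; exact h7 x κ

/-- **★★★ THE SAME WITH THE WINDOW PRODUCED** (Theorem 4's «there exists a constant c₁»: n16-c's `exists_window_print` at the UNIFORM thresholds `c₄, c₃ > 0`): `∃ c₁′ > 0` carrying the
eleven-line window AND, for every `k ≥ 1`, node N16's chain-entry `Thm4TorusAt` at `Nper·Lᵏ` — the two things `n16_holder_of_thm4TorusAt_print` asks of its `c₁` and its (T4ᵀ_print)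
hypothesis, from node N05's Σ-bodies `hΣ`. [cite: Balaban1985RegularSpaces, Thm 4 p.88 («There exists a constant c₁»), Prop. 3 p.87, (1.36)–(1.39) pp.82–83] -/
theorem exists_window_thm4TorusAt_entry_forall_depth_of_uniform_bodies {θ : Stage3Params} (hD : 2 ≤ θ.D) {Nper : ℕ} (hN : 1 ≤ Nper) (Mκ Rκ : ℕ)
    {β : ℝ} (hβ : 0 ≤ β) {len : Site θ.D → ℝ} (hlen : ∀ v : Site θ.D, 0 < len v → 1 ≤ len v) (hlen1 : ∀ μ : Fin θ.D, len (e μ) = 1)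
    {c₄ c₃ B₁' C₂ B₀β : ℝ} {inp : B8.B9Inputs} (hc₄ : 0 < c₄) (hc₃ : 0 < c₃) (hB₁' : 0 < B₁') (hBB : 5 * (θ.D : ℝ) * θ.L * inp.B₀ ≤ B₁')
    (hSig : ∀ k, 1 ≤ k → ∀ a : IdxB8SubDPerκ θ (Nper * θ.L ^ k) Mκ Rκ,
      B8.Thm4Body c₄ B₁' (fun _ : Unit => (zdGF3HP₂Per θ.𝔸 θ.L β len a.toZdIdx (Nper * θ.L ^ k)).toGFData) ∧
      B8.Prop3Body c₃ θ.D (θ.L : ℝ) C₂ inp B₀β (fun _ : Unit => (zdGF3HP₂Per θ.𝔸 θ.L β len a.toZdIdx (Nper * θ.L ^ k)).toGFData2))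
    (Reg : ℕ → (Site θ.D → Fin θ.D → θ.𝔸ˣ) → Prop) :
    ∃ c₁' : ℝ, 0 < c₁' ∧
      (∀ α₀ α₁ : ℝ, 0 < α₀ → 0 < α₁ → α₀ + α₁ ≤ c₁' →
        α₀ + α₁ ≤ c₄ ∧ C0 θ.D * (2 * α₀) ≤ 1 / 3 ∧ 4 * α₀ ≤ c2' θ.D θ.L ∧ 16 * (B₁' * (α₀ + α₁)) ≤ 1 ∧
        Real.exp (4 * (800 * ((θ.D : ℝ) + 1) ^ 2 * ((θ.D : ℝ) + 4)) * α₀) * (1 + 8 * (131072 * ((θ.D : ℝ) + 1) ^ 2) * (B₁' * (α₀ + α₁))) ≤ 2 ∧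
        2 * (B₁' * (α₀ + α₁)) ≤ c3 θ.D θ.L ∧ (θ.D : ℝ) * θ.L * α₁ ≤ 1 / 8 ∧ α₀ ≤ c₃ ∧ α₁ ≤ c₃ ∧ B₁' * (α₀ + α₁) ≤ c₃ ∧
        2 * (B₁' * (α₀ + α₁)) ^ 2 + 20 * θ.D * α₀ * (B₁' * (α₀ + α₁)) + 2 * C₂ * (B₁' * (α₀ + α₁)) ^ 2 ≤ α₀ + α₁) ∧
      ∀ k, 1 ≤ k → Thm4TorusAt θ.L k (((Nper * θ.L ^ k : ℕ) : ℤ)) (((θ.L : ℝ) ^ k)⁻¹) c₁' (unitaryUnits θ.𝔸) (Reg k) (Restr129 θ.L k (torusLam k))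
        (fun (α₀ α₁ : ℝ) (U₀ U' : Site θ.D → Fin θ.D → θ.𝔸ˣ) (u : Site θ.D → θ.𝔸ˣ) =>
          ∃ A : Site θ.D → Fin θ.D → θ.𝔸,
            (∀ x μ, IsSelfAdjoint (A x μ)) ∧ (∀ (x : Site θ.D) (κ μ : Fin θ.D), A (x + (((Nper * θ.L ^ k : ℕ) : ℤ)) • e κ) μ = A x μ) ∧
            mgauge U₀ u (cfgExp (((θ.L : ℝ) ^ k)⁻¹) A) = U' ∧
            (∀ x μ, ‖A x μ‖ ≤ 5 * (θ.D : ℝ) * θ.L * inp.B₀ * (α₀ + α₁)) ∧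
            (∀ (μ : Fin θ.D) (x : Site θ.D) (κ : Fin θ.D),
              ‖covDerivFwd (((θ.L : ℝ) ^ k)⁻¹) U₀ μ (fun z => A z κ) x‖ ≤ 5 * (θ.D : ℝ) * θ.L * inp.B₀ * (α₀ + α₁)) ∧
            IsLandau138 θ.L k (((θ.L : ℝ) ^ k)⁻¹) Set.univ (torusLam k) U₀ A ∧
            (∀ (μ : Fin θ.D) (y : Site θ.D) (κ : Fin θ.D),
              ‖conjR (U₀ y μ) (covDerivFwd (((θ.L : ℝ) ^ k)⁻¹) U₀ μ (fun z => A z κ) (y + e μ)) - covDerivFwd (((θ.L : ℝ) ^ k)⁻¹) U₀ μ (fun z => A z κ) y‖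
                ≤ 5 * (θ.D : ℝ) * θ.L * B₀β * (α₀ + α₁) * (((θ.L : ℝ)⁻¹) ^ k) ^ β) ∧
            (∀ (x : Site θ.D) (κ : Fin θ.D),
              ‖covLap (((θ.L : ℝ) ^ k)⁻¹) U₀ (fun z => A z κ) x‖ ≤ 5 * (θ.D : ℝ) * θ.L * inp.B₀ * (α₀ + α₁))) := by
  obtain ⟨c₁', hc₁', hwin⟩ := exists_window_print (d := θ.D) (L := θ.L) hD θ.two_le_L C₂ hc₄ hc₃ hB₁'
  exact ⟨c₁', hc₁', hwin, thm4TorusAt_entry_forall_depth_of_uniform_bodies hD hN Mκ Rκ hβ hlen hlen1 hB₁' hBB hwin hSig Reg⟩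

end

end Summit.QuantumFields.YangMills.BalabanUVNodes.N16.Thm4TorusOfHP2PerUniform
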